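import Mathlib
import HarnessLib.Audit
import Summits.PneNP.PneNP.Theorems.PstarChordBridgeForcing
import Summits.PneNP.PneNP.Theorems.PstarChordBridgeCotree

/-!
# Exchange: minimality in a FOREST edge of the core, in bridge form (ROUND-24, memo §1 / §11 (N2); GAPTWO-PLAN S4)

FRONTIER range-avoidance ladder, rung F-N3, ROUND 24 (cell `pnp-ideate`, planner memo `r24/CORE-BOUND-NOTES.md` §11 (N2) ("MINIMAL in `j ∈ J₀` ⟺ feasible
after replacing `𝒞(G)` by `𝒞(G − j)` … for a bridge `j` nothing changes in `𝒞`"), §4 end / §5 (minimality of path edges: "the cycle `P_e + e` is not even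
minimal"); restricted-model proof complexity — nothing here bears on `P` versus `NP`).

The bridge (`PstarChordBridge`) transfers output-minimality (M0) only for CHORDS (`chordMinimal_of_solution_erase`).  Minimality in a NON-CHORD output
`j` (a forest edge lying on the fundamental set `D e₁` of some chord `e₁`) is captured by an EXCHANGE: delete `j`, promote `e₁` to a forest edge, and
re-route every fundamental set and join through the cycle `D e₁ + e₁` — pure parity algebra, no paths:

* `exchange B j e₁` — the bridge data of the core `J₀ − j` with chords `N − e₁`, fundamental sets `D e ∆ (D e₁ + e₁)` for the chords through `j`,
  joins `Tᵢ ∆ (D e₁ + e₁)` for the joins through `j`;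
* `exchange_wf` — it is well formed whenever `B` is (`j ∈ D e₁`, `e₁ ∈ N`); `xverts_exchange` — the new forest has the same XOR vertices;
* `sys_exchange_u` — its prescribed products: `u'_e = u_e + [j ∈ D e]·(u_{e₁} + x_{p₁} x_{q₁})`, i.e. shifted by the DEFECT
  `δ = u_{e₁} + m_{e₁}` of the promoted chord on the chords whose cycle ran through `j`;
* `not_infeasible_exchange` — **(M0) at the forest edge `j` makes the exchanged system feasible**.

The translation back into the coordinates of `B` (`free_exchange`, `forest_minimality`: `p_e q_e = u_e + [j ∈ D e]·δ` and
`val N x s = t + δ·([j ∈ T₁], [j ∈ T₂])` with the defect `δ := u_{e₁} + m_{e₁}`, and `defect_eq_one`: (T3) forces `δ = 1`) is the companion file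
`PstarChordBridgeForest`.
-/

set_option linter.dupNamespace false -- `Summit.PneNP.PneNP.…`: summit = sub-problem name (D-0017 single-conjunct layout)

open Finset Literature.Computability.Complexity
open scoped symmDiff
open Summit.PneNP.PneNP.Theorems.PstarFibrePolys (bit bit_xor bit_and bit_injective)
open Summit.PneNP.PneNP.Theorems.PstarPDT (parity bit_eval)
open Summit.PneNP.PneNP.Theorems.PstarTyped (Typed)
open Summit.PneNP.PneNP.Theorems.PstarSALevel (varSet bdry)
open Summit.PneNP.PneNP.Theorems.PstarGapOneAll (gval)
open Summit.PneNP.PneNP.Theorems.PstarXorElimination (pdeg)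
open Summit.PneNP.PneNP.Theorems.PstarXCore (xpair xverts mem_xpair)
open Summit.PneNP.PneNP.Theorems.PstarChordRepair (IsChord)
open Summit.PneNP.PneNP.Theorems.PstarCentreFree (vars_mem_varSet)
open Summit.PneNP.PneNP.Theorems.PstarGraphQuadGapTwoForms (sum_symmDiff_zmod2)
open Summit.PneNP.PneNP.Theorems.PstarReadSumset (V2)
open Summit.PneNP.PneNP.Theorems.PstarChordSystem (ChordSystem)
open Summit.PneNP.PneNP.Theorems.PstarChordBridgeTools
open Summit.PneNP.PneNP.Theorems.PstarChordBridge
open Summit.PneNP.PneNP.Theorems.PstarChordBridgeFundamental (xpdeg_insert odd_of_end exists_mem_of_odd)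
open Summit.PneNP.PneNP.Theorems.PstarChordBridgeForcing (coef_of_unread)
open Summit.PneNP.PneNP.Theorems.PstarChordBridgeCotree (mem_xverts_iff_xpdeg_pos)

namespace Summit.PneNP.PneNP.Theorems.PstarChordBridgeExchange

variable {n m : ℕ}

/-! ## Parities of symmetric differences -/

/-- The slot-degree in `𝔽₂` as a sum of indicators. -/
theorem xpdeg_cast (I : LocalMap 4 n m) (E : Finset (Fin m)) (w : Fin n) :
    (xpdeg I E w : ZMod 2) = ∑ k ∈ E, ((if I.vars k 0 = w then (1 : ZMod 2) else 0) + (if I.vars k 1 = w then 1 else 0)) := by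
  unfold xpdeg pdeg
  rw [Nat.cast_add, card_filter, card_filter, Nat.cast_sum, Nat.cast_sum, ← sum_add_distrib]
  refine sum_congr rfl fun k _ => ?_
  by_cases h0 : I.vars k 0 = w <;> by_cases h1 : I.vars k 1 = w <;> simp [h0, h1]

/-- **Slot-degrees of a symmetric difference add up in `𝔽₂`.** -/
theorem xpdeg_symmDiff_cast (I : LocalMap 4 n m) (A C : Finset (Fin m)) (w : Fin n) :
    (xpdeg I (A ∆ C) w : ZMod 2) = xpdeg I A w + xpdeg I C w := by
  classical
  rw [xpdeg_cast, xpdeg_cast, xpdeg_cast, sum_symmDiff_zmod2]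

/-- Oddness of a symmetric difference with an everywhere-even set. -/
theorem odd_xpdeg_symmDiff_iff (I : LocalMap 4 n m) {A C : Finset (Fin m)} (hC : ∀ w, Even (xpdeg I C w)) (w : Fin n) :
    Odd (xpdeg I (A ∆ C) w) ↔ Odd (xpdeg I A w) := by
  rw [← ZMod.natCast_eq_one_iff_odd, ← ZMod.natCast_eq_one_iff_odd, xpdeg_symmDiff_cast, (ZMod.natCast_eq_zero_iff_even).2 (hC w), add_zero]

/-- Evenness of a symmetric difference of everywhere-even sets. -/
theorem even_xpdeg_symmDiff (I : LocalMap 4 n m) {A C : Finset (Fin m)} (hA : ∀ w, Even (xpdeg I A w)) (hC : ∀ w, Even (xpdeg I C w))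
    (w : Fin n) : Even (xpdeg I (A ∆ C) w) := by
  rw [← ZMod.natCast_eq_zero_iff_even, xpdeg_symmDiff_cast, (ZMod.natCast_eq_zero_iff_even).2 (hA w), (ZMod.natCast_eq_zero_iff_even).2 (hC w),
    add_zero]

/-- **Re-routing a prescribed product**: `uval` over `D ∆ C` is `uval` over `D` plus the sum over `C`. -/
theorem uval_symmDiff (I : LocalMap 4 n m) (y : Fin m → Bool) (D C : Finset (Fin m)) (e : Fin m) (x : Fin n → ZMod 2) :
    uval I y (D ∆ C) e x = uval I y D e x + ∑ k ∈ C, (bit (y k) + x (I.vars k 2) * x (I.vars k 3)) := by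
  classical
  unfold uval
  rw [sum_symmDiff_zmod2, add_assoc]

/-- The sum over a fundamental cycle `D e₁ + e₁` is the defect `u_{e₁} + m_{e₁}`. -/
theorem sum_insert_eq_uval (I : LocalMap 4 n m) (y : Fin m → Bool) {D : Finset (Fin m)} {e₁ : Fin m} (he : e₁ ∉ D) (x : Fin n → ZMod 2) :
    ∑ k ∈ insert e₁ D, (bit (y k) + x (I.vars k 2) * x (I.vars k 3)) = uval I y D e₁ x + x (I.vars e₁ 2) * x (I.vars e₁ 3) := by
  rw [sum_insert he]
  unfold uval
  ring

/-! ## The exchange -/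

/-- **Exchange** `j ↔ e₁`: delete the forest edge `j`, promote the chord `e₁` (whose fundamental set contains `j`) to the forest, re-route. -/
def exchange (B : BridgeData n m) (j e₁ : Fin m) : BridgeData n m where
  y := B.y
  J₀ := B.J₀.erase j
  N := B.N.erase e₁
  D e := if j ∈ B.D e then B.D e ∆ insert e₁ (B.D e₁) else B.D e
  C₁ := B.C₁
  G₁ := B.G₁
  b₁ := B.b₁
  T₁ := if j ∈ B.T₁ then B.T₁ ∆ insert e₁ (B.D e₁) else B.T₁
  C₂ := B.C₂
  G₂ := B.G₂
  b₂ := B.b₂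
  T₂ := if j ∈ B.T₂ then B.T₂ ∆ insert e₁ (B.D e₁) else B.T₂

/-- The solutions of the exchanged data are the solutions of the original data (same targets and constraints). -/
theorem solution_exchange (I : LocalMap 4 n m) (B : BridgeData n m) (j e₁ : Fin m) (K : Finset (Fin m)) (z : Fin n → Bool) :
    Solution I (exchange B j e₁) K z ↔ Solution I B K z := Iff.rfl

/-- The new forest is the old one with `j` replaced by `e₁`. -/
theorem sdiff_exchange {B : BridgeData n m} (hW_N : B.N ⊆ B.J₀) {j e₁ : Fin m} (hj : j ∉ B.N) (he₁ : e₁ ∈ B.N) :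
    (exchange B j e₁).J₀ \ (exchange B j e₁).N = insert e₁ ((B.J₀ \ B.N).erase j) := by
  ext k
  simp only [exchange, mem_sdiff, mem_erase, mem_insert]
  constructor
  · rintro ⟨⟨hkj, hkJ⟩, hk⟩
    by_cases hke : k = e₁
    · exact Or.inl hke
    · exact Or.inr ⟨hkj, hkJ, fun hkN => hk ⟨hke, hkN⟩⟩
  · rintro (rfl | ⟨hkj, hkJ, hkN⟩)
    · exact ⟨⟨fun h => hj (h ▸ he₁), hW_N he₁⟩, fun h => h.1 rfl⟩
    · exact ⟨⟨hkj, hkJ⟩, fun h => hkN h.2⟩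

/-! ## Well-formedness of the exchange -/

/-- Membership in `xverts`. -/
theorem mem_xverts_iff (I : LocalMap 4 n m) (S : Finset (Fin m)) (v : Fin n) : v ∈ xverts I S ↔ ∃ k ∈ S, v ∈ xpair I k := by
  unfold PstarXCore.xverts; rw [mem_biUnion]

/-- A boundary variable stays a boundary variable of a subfamily that still reads it. -/
theorem mem_bdry_erase (I : LocalMap 4 n m) {X : Finset (Fin m)} {v : Fin n} (hv : v ∈ bdry I X) {e j : Fin m} (he : e ∈ X) (hej : e ≠ j)
    (hve : v ∈ varSet I e) : v ∈ bdry I (X.erase j) := by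
  classical
  unfold PstarSALevel.bdry at hv ⊢
  rw [mem_filter] at hv ⊢
  refine ⟨mem_univ v, le_antisymm ?_ ?_⟩
  · rw [← hv.2]; exact card_le_card (filter_subset_filter _ (erase_subset j X))
  · exact card_pos.2 ⟨e, mem_filter.2 ⟨mem_erase.2 ⟨hej, he⟩, hve⟩⟩

/-- Re-routed sets stay inside the new forest. -/
theorem symmDiff_subset_exchange {F A D₁ : Finset (Fin m)} {j e₁ : Fin m} (hA : A ⊆ F) (hjA : j ∈ A) (hD : D₁ ⊆ F) (hjD : j ∈ D₁) :
    A ∆ insert e₁ D₁ ⊆ insert e₁ (F.erase j) := by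
  intro k hk
  rw [mem_symmDiff] at hk
  rw [mem_insert, mem_erase]
  rcases hk with ⟨hkA, hkC⟩ | ⟨hkC, hkA⟩
  · right
    exact ⟨fun h => hkC (h ▸ mem_insert_of_mem hjD), hA hkA⟩
  · rcases mem_insert.1 hkC with rfl | hkD
    · exact Or.inl rfl
    · exact Or.inr ⟨fun h => hkA (h ▸ hjA), hD hkD⟩

/-- Inserting an element outside `C` commutes with `∆ C`. -/
theorem insert_symmDiff_of_not_mem {A C : Finset (Fin m)} {e : Fin m} (he : e ∉ C) : insert e (A ∆ C) = (insert e A) ∆ C := by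
  ext k
  rw [mem_insert, mem_symmDiff, mem_symmDiff, mem_insert]
  by_cases hke : k = e
  · subst hke; simp [he]
  · simp [hke]

/-- `privs` is monotone. -/
theorem privs_mono (I : LocalMap 4 n m) {N N' : Finset (Fin m)} (h : N' ⊆ N) : privs I N' ⊆ privs I N := by
  unfold privs; exact biUnion_subset_biUnion_of_subset_left _ h

/-- **The exchanged forest has the same XOR vertices.** -/
theorem xverts_exchange (I : LocalMap 4 n m) (hI : I.IsPure xorAndPred) {B : BridgeData n m} (hW : B.WF I) {j e₁ : Fin m} (he₁ : e₁ ∈ B.N)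
    (hj : j ∈ B.D e₁) : xverts I ((exchange B j e₁).J₀ \ (exchange B j e₁).N) = xverts I (B.J₀ \ B.N) := by
  classical
  have hjF : j ∈ B.J₀ \ B.N := hW.hD e₁ he₁ hj
  have he₁D : e₁ ∉ B.D e₁ := fun h => (mem_sdiff.1 (hW.hD e₁ he₁ h)).2 he₁
  rw [sdiff_exchange hW.hN (mem_sdiff.1 hjF).2 he₁]
  ext v
  rw [mem_xverts_iff, mem_xverts_iff]
  constructor
  · rintro ⟨k, hk, hv⟩
    rcases mem_insert.1 hk with rfl | hk
    · -- an end of `e₁` is an odd vertex of `D e₁`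
      rcases (mem_xpair I).1 hv with rfl | rfl
      · obtain ⟨k', hk', hv'⟩ := exists_mem_of_odd I (odd_of_end I hI he₁D (hW.hDeven _ he₁) (s := 0) (by decide))
        exact ⟨k', hW.hD _ he₁ hk', hv'⟩
      · obtain ⟨k', hk', hv'⟩ := exists_mem_of_odd I (odd_of_end I hI he₁D (hW.hDeven _ he₁) (s := 1) (by decide))
        exact ⟨k', hW.hD _ he₁ hk', hv'⟩
    · exact ⟨k, mem_of_mem_erase hk, hv⟩
  · rintro ⟨k, hk, hv⟩
    by_cases hkj : k = j
    · subst hkj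
      -- `v` has even degree in `D e₁ + e₁` and `k` touches it once: another member touches it
      have hev := hW.hDeven e₁ he₁ v
      have hkE : k ∈ insert e₁ (B.D e₁) := mem_insert_of_mem hj
      rw [← insert_erase hkE, xpdeg_insert I (fun h => (mem_erase.1 h).1 rfl)] at hev
      have h01 : I.vars k 0 ≠ I.vars k 1 := fun h => absurd (hI.2 k h) (by decide)
      have hodd : Odd (xpdeg I ((insert e₁ (B.D e₁)).erase k) v) := by
        rcases (mem_xpair I).1 hv with rfl | rfl
        · rw [if_pos rfl, if_neg (Ne.symm h01), add_zero] at hev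
          by_contra hno; rw [Nat.not_odd_iff_even] at hno
          exact Nat.not_even_iff_odd.2 (Even.add_one hno) hev
        · rw [if_neg h01, if_pos rfl] at hev
          by_contra hno; rw [Nat.not_odd_iff_even] at hno
          exact Nat.not_even_iff_odd.2 (Even.add_one hno) (by simpa using hev)
      obtain ⟨k', hk', hv'⟩ := exists_mem_of_odd I hodd
      rcases mem_insert.1 (mem_of_mem_erase hk') with rfl | hk'D
      · exact ⟨k', mem_insert_self _ _, hv'⟩
      · exact ⟨k', mem_insert_of_mem (mem_erase.2 ⟨ne_of_mem_erase hk', hW.hD _ he₁ hk'D⟩), hv'⟩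
    · exact ⟨k, mem_insert_of_mem (mem_erase.2 ⟨hkj, hk⟩), hv⟩

/-- **The exchange is well formed.** -/
theorem exchange_wf (I : LocalMap 4 n m) (hI : I.IsPure xorAndPred) {B : BridgeData n m} (hW : B.WF I) {j e₁ : Fin m} (he₁ : e₁ ∈ B.N)
    (hj : j ∈ B.D e₁) : (exchange B j e₁).WF I := by
  classical
  have hjF : j ∈ B.J₀ \ B.N := hW.hD e₁ he₁ hj
  have hjN : j ∉ B.N := (mem_sdiff.1 hjF).2
  have he₁D : e₁ ∉ B.D e₁ := fun h => (mem_sdiff.1 (hW.hD e₁ he₁ h)).2 he₁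
  have hCev : ∀ w, Even (xpdeg I (insert e₁ (B.D e₁)) w) := hW.hDeven e₁ he₁
  have hF' := sdiff_exchange hW.hN hjN he₁ (j := j)
  have hDsub : B.D e₁ ⊆ B.J₀ \ B.N := hW.hD e₁ he₁
  refine
    { hN := fun e he => ?_
      hchord := fun e he => ?_
      hD := fun e he => ?_
      hDeven := fun e he => ?_
      hT₁ := ?_
      hT₂ := ?_
      hjoin₁ := fun w => ?_
      hjoin₂ := fun w => ?_
      hcross₁ := fun g hg h => hW.hcross₁ g hg ⟨privs_mono I (erase_subset _ _) h.1, privs_mono I (erase_subset _ _) h.2⟩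
      hcross₂ := fun g hg h => hW.hcross₂ g hg ⟨privs_mono I (erase_subset _ _) h.1, privs_mono I (erase_subset _ _) h.2⟩ }
  · -- chords stay inside the smaller core
    have he' := mem_erase.1 he
    exact mem_erase.2 ⟨fun h => hjN (h ▸ he'.2), hW.hN he'.2⟩
  · have he' := mem_erase.1 he
    have hne : e ≠ j := fun h => hjN (h ▸ he'.2)
    obtain ⟨h2, h3⟩ := hW.hchord e he'.2
    exact ⟨mem_bdry_erase I h2 (hW.hN he'.2) hne (vars_mem_varSet I e 2), mem_bdry_erase I h3 (hW.hN he'.2) hne (vars_mem_varSet I e 3)⟩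
  · have he' := mem_erase.1 he
    show (if j ∈ B.D e then B.D e ∆ insert e₁ (B.D e₁) else B.D e) ⊆ (exchange B j e₁).J₀ \ (exchange B j e₁).N
    rw [hF']
    split_ifs with hje
    · exact symmDiff_subset_exchange (hW.hD e he'.2) hje hDsub hj
    · intro k hk
      exact mem_insert_of_mem (mem_erase.2 ⟨fun h => hje (h ▸ hk), hW.hD e he'.2 hk⟩)
  · have he' := mem_erase.1 he
    intro w
    show Even (xpdeg I (insert e (if j ∈ B.D e then B.D e ∆ insert e₁ (B.D e₁) else B.D e)) w)
    split_ifs with hje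
    · have heC : e ∉ insert e₁ (B.D e₁) := fun h => by
        rcases mem_insert.1 h with h | h
        · exact he'.1 h
        · exact (mem_sdiff.1 (hDsub h)).2 he'.2
      rw [insert_symmDiff_of_not_mem heC]
      exact even_xpdeg_symmDiff I (hW.hDeven e he'.2) hCev w
    · exact hW.hDeven e he'.2 w
  · show (if j ∈ B.T₁ then B.T₁ ∆ insert e₁ (B.D e₁) else B.T₁) ⊆ (exchange B j e₁).J₀ \ (exchange B j e₁).N
    rw [hF']
    split_ifs with hjT
    · exact symmDiff_subset_exchange hW.hT₁ hjT hDsub hj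
    · exact fun k hk => mem_insert_of_mem (mem_erase.2 ⟨fun h => hjT (h ▸ hk), hW.hT₁ hk⟩)
  · show (if j ∈ B.T₂ then B.T₂ ∆ insert e₁ (B.D e₁) else B.T₂) ⊆ (exchange B j e₁).J₀ \ (exchange B j e₁).N
    rw [hF']
    split_ifs with hjT
    · exact symmDiff_subset_exchange hW.hT₂ hjT hDsub hj
    · exact fun k hk => mem_insert_of_mem (mem_erase.2 ⟨fun h => hjT (h ▸ hk), hW.hT₂ hk⟩)
  · rw [xverts_exchange I hI hW he₁ hj]
    show Odd (xpdeg I (if j ∈ B.T₁ then B.T₁ ∆ insert e₁ (B.D e₁) else B.T₁) w) ↔ w ∈ B.C₁ ∧ w ∈ xverts I (B.J₀ \ B.N)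
    split_ifs with hjT
    · rw [odd_xpdeg_symmDiff_iff I hCev]; exact hW.hjoin₁ w
    · exact hW.hjoin₁ w
  · rw [xverts_exchange I hI hW he₁ hj]
    show Odd (xpdeg I (if j ∈ B.T₂ then B.T₂ ∆ insert e₁ (B.D e₁) else B.T₂) w) ↔ w ∈ B.C₂ ∧ w ∈ xverts I (B.J₀ \ B.N)
    split_ifs with hjT
    · rw [odd_xpdeg_symmDiff_iff I hCev]; exact hW.hjoin₂ w
    · exact hW.hjoin₂ w

/-! ## The exchanged chord system -/

/-- **Prescribed products after the exchange**: shifted by the defect of the promoted chord on the chords through `j`. -/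
theorem sys_exchange_u (I : LocalMap 4 n m) {B : BridgeData n m} (hW : B.WF I) {j e₁ : Fin m} (he₁ : e₁ ∈ B.N) (e : Fin m) (x : Fin n → ZMod 2) :
    (sys I (exchange B j e₁)).u e x =
      (sys I B).u e x + (if j ∈ B.D e then (sys I B).u e₁ x + x (I.vars e₁ 2) * x (I.vars e₁ 3) else 0) := by
  classical
  have he₁D : e₁ ∉ B.D e₁ := fun h => (mem_sdiff.1 (hW.hD e₁ he₁ h)).2 he₁
  rw [sys_u, sys_u, sys_u]
  show uval I B.y (if j ∈ B.D e then B.D e ∆ insert e₁ (B.D e₁) else B.D e) e x = _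
  split_ifs with hje
  · rw [uval_symmDiff, sum_insert_eq_uval I B.y he₁D]
  · rw [add_zero]

/-- **(M0) at a forest edge makes the exchanged system feasible.** -/
theorem not_infeasible_exchange (I : LocalMap 4 n m) (hI : I.IsPure xorAndPred) (hT : Typed I) {B : BridgeData n m} (hW : B.WF I)
    {j e₁ : Fin m} (he₁ : e₁ ∈ B.N) (hj : j ∈ B.D e₁) {z : Fin n → Bool} (hz : Solution I B (B.J₀.erase j) z) :
    ¬ (sys I (exchange B j e₁)).Infeasible (B.N.erase e₁) :=
  not_infeasible_of_solution I hI hT (exchange_wf I hI hW he₁ hj) (z := z) hz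

end Summit.PneNP.PneNP.Theorems.PstarChordBridgeExchange
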